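import Mathlib
import Summits.CriticalPhenomena.CardyFormulaZ2.Theorems.CardySelfRefinementDefs
import Summits.CriticalPhenomena.CardyFormulaZ2.Theorems.CardySelfRefinementRussoDriftModel
import Summits.CriticalPhenomena.CardyFormulaZ2.Theorems.CardySelfRefinementTrivialSectorRateStubSixArmSectorMassFactorisation
import Literature.Probability.Percolation.FourArmGarbanCircuitBits
import Literature.Probability.Percolation.FourArmGarbanTwoArms
import Literature.Probability.Percolation.CrossingClusterBlockEstimate
import Literature.Probability.Percolation.SelfRefinementMeasure
import Literature.Probability.LatticeModels.ProdBernoulliIndependence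
import HarnessLib

/-!
# Helper (M3), part 1 (locality and independence), of stub `stub_fourArmAboveOne`, line
`far-field-is-a-quarter-turn` (crux `TrivialSectorRate`, stmt-CriticalPhenomena-10266):
no dual circuit in `J` separated annuli costs `q^J` under `M_k`

Measure-generic half of the two-arm decay (M3) (`openDualArmsAt_decay_along`, file
`…StubFourArmAboveOneTwoArms.lean`, hypothesis `h₂` of `fourArmAboveOneAlong_of_garbanScheme`):

* the open arm of `openDualArmsAt c m n` is an open lattice walk from `c + B(m-1)` to the outside
  of `c + B(n-1)`; it excludes a closed dual circuit in every annulus `c' + A_{aᵢ,bᵢ}`,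
  `c' = c - (1,1)`, `m ≤ aᵢ ≤ bᵢ ≤ n - 1` (`not_mem_dualCircuitInAnnulusAt_of_openWalk`), so
  `M_k(openDualArmsAt c m n) ≤ M_k(⋂ᵢ no dual circuit in the i-th annulus)`
  (`real_openDualArmsAt_le_real_biInter`; `M_k` is carried by lattice configurations);
* the dual circuit event of `c' + A_{a,b}` is a cylinder over the primal edges dual to the pairs
  of annulus sites (`determinedBy_dualCircuitInAnnulusAt_annulus`), and two fine edges of `ℤ²`
  reading a common coin of `M_k` have the same coarse base, hence lie within sup-distance `< k`
  of each other (`tb_eq_of_mem_coinsOf`, `abs_sub_lt_of_tb_eq`): for `k`-separated annuli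
  (`bᵢ + k ≤ aⱼ`) the pulled-back events read pairwise DISJOINT finite coin sets
  (`disjoint_coinsOf_of_annuli`), so they are independent under the coin product
  (`prodBernoulli_real_inter_biInter_of_determinedBy`):
  `M_k(⋂ᵢ no dual circuitᵢ) = ∏ᵢ (1 - M_k(dual circuitᵢ))`
  (`real_biInter_compl_dualCircuitInAnnulusAt_eq_prod`);
* with the geometric annuli `aᵢ = 4ⁱ m`, `bᵢ = 2 aᵢ`, `i < J`, `2·4^{J-1} m + 1 ≤ n`, and a uniform
  thin-annulus circuit bound `M_k(dual circuit) ≥ 1 - q`, the product is `≤ q^J`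
  (`real_openDualArmsAt_le_pow`, registered helper).

References: O. Schramm, S. Smirnov (app. C. Garban), Ann. Probab. 39 (2011), App. B, (B.6);
J. van den Berg, P. Nolin, Progr. Probab. 77 (2020), §5.2; G. Grimmett, *Percolation* (1999),
§2.2 and §11.7.

Target file:
`Summits/CriticalPhenomena/CardyFormulaZ2/Theorems/CardySelfRefinementTrivialSectorRateStubFourArmAboveOneTwoArmsLocality.lean`.
-/

noncomputable section

namespace Summit.CriticalPhenomena.CardyFormulaZ2.Theorems.CardySelfRefinement.FarField

open Set MeasureTheory
open Literature.Probability.LatticeModels Literature.Probability.Percolation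
open Literature.Probability.Percolation.QuadCrossing
open Summit.CriticalPhenomena.CardyFormulaZ2.Theses.CardySelfRefinement

/-! ### Locality of the circuit events: the pairs of annulus sites suffice -/

/-- The complement of an event determined by `K` is determined by `K` (local copy of
`DeterminedBy.compl` of `SiteMonotonicity.lean`, not imported here). -/
private theorem determinedBy_compl_aux {ι : Type*} {A : Set (Set ι)} {K : Set ι}
    (h : DeterminedBy A K) : DeterminedBy Aᶜ K := by
  rw [determinedBy_iff] at h ⊢
  intro ω ω' hω
  rw [Set.mem_compl_iff, Set.mem_compl_iff, h ω ω' hω]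

/-- **Sharper locality of the open circuit event**: `openCircuitInAnnulusAt c a b` depends only on
the pairs of sites of the translated annulus `c + A_{a,b}` (all vertices of the circuit lie there;
compare `determinedBy_openCircuitInAnnulusAt`, which uses the full box `c + B(b)`). -/
theorem determinedBy_openCircuitInAnnulusAt_annulus (c : Site 2) (a b : ℕ) :
    DeterminedBy (openCircuitInAnnulusAt c a b)
      (↑(((annulus 2 (a - 1) b).image (· + c)).sym2) : Set (Sym2 (Site 2))) := by
  rw [determinedBy_iff]
  suffices h : ∀ ω ω' : Set (Sym2 (Site 2)),
      ω ∩ (↑(((annulus 2 (a - 1) b).image (· + c)).sym2) : Set (Sym2 (Site 2))) =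
        ω' ∩ ↑(((annulus 2 (a - 1) b).image (· + c)).sym2) →
      ω ∈ openCircuitInAnnulusAt c a b → ω' ∈ openCircuitInAnnulusAt c a b from
    fun ω ω' hF => ⟨h ω ω' hF, h ω' ω hF.symm⟩
  rintro ω ω' hF ⟨u, w, hc, hs, he, ho⟩
  refine ⟨u, w, hc, hs, fun e he' => ?_, ho⟩
  have heF : e ∈ (↑(((annulus 2 (a - 1) b).image (· + c)).sym2) : Set (Sym2 (Site 2))) := by
    rw [Finset.mem_coe, Finset.mem_sym2_iff]
    intro x hx
    rw [Finset.mem_image]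
    exact ⟨x - c, hs x (w.mem_support_of_mem_edges he' hx), sub_add_cancel x c⟩
  have : e ∈ ω ∩ ↑(((annulus 2 (a - 1) b).image (· + c)).sym2) := ⟨he e he', heF⟩
  rw [hF] at this
  exact this.1

/-- **Locality of the closed dual circuit event**: `dualCircuitInAnnulusAt c a b` depends only on
the primal edges whose dual edges join two (dual vertices indexed by) sites of `c + A_{a,b}`. -/
theorem determinedBy_dualCircuitInAnnulusAt_annulus (c : Site 2) (a b : ℕ) :
    DeterminedBy (dualCircuitInAnnulusAt c a b)
      (dualEdge ⁻¹' (↑(((annulus 2 (a - 1) b).image (· + c)).sym2) : Set (Sym2 (Site 2)))) :=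
  (determinedBy_openCircuitInAnnulusAt_annulus c a b).preimage_dualConfig

/-- The determining edge set of the dual circuit event is finite (`dualEdge` is a bijection). -/
theorem finite_dualEdge_preimage_annulusPairs (c : Site 2) (a b : ℕ) :
    (dualEdge ⁻¹' (↑(((annulus 2 (a - 1) b).image (· + c)).sym2) : Set (Sym2 (Site 2)))).Finite :=
  Set.Finite.preimage dualEdge_bijective.injective.injOn (Finset.finite_toSet _)

/-! ### Coins of `M_k` read by separated annuli are disjoint -/

/-- A fine edge `edgeOf vd = {v, v + e_d}` whose dual edge `{v - e_{d'}, v}` joins two sites of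
`c + A_{a,b}` has its base vertex `v` in `c + A_{a,b}`. -/
theorem fst_sub_mem_annulus_of_edgeOf_mem {c : Site 2} {a b : ℕ} {vd : Site 2 × Fin 2}
    (h : edgeOf vd ∈
      dualEdge ⁻¹' (↑(((annulus 2 (a - 1) b).image (· + c)).sym2) : Set (Sym2 (Site 2)))) :
    vd.1 - c ∈ annulus 2 (a - 1) b := by
  obtain ⟨v, d⟩ := vd
  have h' : dualEdge s(v, v + dirVec d) ∈
      (↑(((annulus 2 (a - 1) b).image (· + c)).sym2) : Set (Sym2 (Site 2))) := h
  rw [show (dirVec d : Site 2) = Pi.single d 1 from dirVec_eq_single d] at h'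
  obtain ⟨d', hd'⟩ : ∃ d' : Fin 2, d ≠ d' := ⟨d + 1, by fin_cases d <;> decide⟩
  rw [dualEdge_single_eq hd', Finset.mem_coe, Finset.mem_sym2_iff] at h'
  obtain ⟨y, hy, hyv⟩ := Finset.mem_image.1 (h' v (Sym2.mem_mk_right _ _))
  show v - c ∈ annulus 2 (a - 1) b
  rw [← (eq_sub_of_add_eq hyv)]
  exact hy

/-- **Coins separate `k`-separated annuli**: if `edgeOf vd` is read by the dual circuit event of
`c + A_{a,b}` and `edgeOf vd'` by that of `c + A_{a',b'}` with `b + k ≤ a'`, then the two fine edges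
read disjoint coin sets (a common coin forces a common coarse base, hence sup-distance `< k`
between the base vertices, while `‖v - c‖_∞ ≤ b` and `‖v' - c‖_∞ ≥ a'`). -/
theorem disjoint_coinsOf_of_annuli {k : ℕ} (hk : 0 < k) {c : Site 2} {a b a' b' : ℕ}
    (hba : b + k ≤ a') {vd vd' : Site 2 × Fin 2}
    (h : edgeOf vd ∈
      dualEdge ⁻¹' (↑(((annulus 2 (a - 1) b).image (· + c)).sym2) : Set (Sym2 (Site 2))))
    (h' : edgeOf vd' ∈
      dualEdge ⁻¹' (↑(((annulus 2 (a' - 1) b').image (· + c)).sym2) : Set (Sym2 (Site 2)))) :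
    Disjoint (coinsOf k vd) (coinsOf k vd') := by
  rw [Set.disjoint_left]
  intro i hi hi'
  obtain ⟨-, htb⟩ := tb_eq_of_mem_coinsOf k hi hi'
  have hv := fst_sub_mem_annulus_of_edgeOf_mem h
  have hv' := fst_sub_mem_annulus_of_edgeOf_mem h'
  rw [mem_annulus] at hv hv'
  refine hv'.2 ?_
  have hvb := hv.1
  rw [mem_box] at hvb ⊢
  intro j
  obtain ⟨hlo, hhi⟩ := hvb j
  obtain ⟨hlt1, hlt2⟩ := abs_sub_lt_of_tb_eq hk htb j
  simp only [Pi.sub_apply] at hlo hhi ⊢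
  constructor <;> omega

/-! ### Independence: no dual circuit in `J` separated annuli -/

/-- **Product formula.**  For annuli `c + A_{aᵢ,bᵢ}` (`i ∈ s`) that are `k`-separated
(`bᵢ + k ≤ aⱼ` for `i < j`), the events "no closed dual circuit in the `i`-th annulus" are
independent under `M_k(ρ,c₀)`:
`M_k(⋂ᵢ (dualCircuitInAnnulusAt c aᵢ bᵢ)ᶜ) = ∏ᵢ (1 - M_k(dualCircuitInAnnulusAt c aᵢ bᵢ))`
(pull back to the coin product through `cfg k`; the pulled-back events are cylinders over pairwise
disjoint finite coin sets). -/
theorem real_biInter_compl_dualCircuitInAnnulusAt_eq_prod {k : ℕ} (hk : 0 < k) (ρ c₀ : ℝ)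
    (c : Site 2) (s : Finset ℕ) (a b : ℕ → ℕ)
    (hfar : ∀ i ∈ s, ∀ j ∈ s, i < j → b i + k ≤ a j) :
    (M k ρ c₀).real (⋂ i ∈ s, (dualCircuitInAnnulusAt c (a i) (b i))ᶜ) =
      ∏ i ∈ s, (1 - (M k ρ c₀).real (dualCircuitInAnnulusAt c (a i) (b i))) := by
  classical
  set D : ℕ → Set (BondConfig (Site 2)) := fun i => dualCircuitInAnnulusAt c (a i) (b i) with hD
  have hDm : ∀ i, MeasurableSet (D i) := fun i => measurableSet_dualCircuitInAnnulusAt c (a i) (b i)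
  have hIm : MeasurableSet (⋂ i ∈ s, (D i)ᶜ) :=
    Finset.measurableSet_biInter s fun i _ => (hDm i).compl
  -- the finite coin supports
  set W : ℕ → Set (Sym2 (Site 2)) := fun i =>
    dualEdge ⁻¹' (↑(((annulus 2 (a i - 1) (b i)).image (· + c)).sym2) : Set (Sym2 (Site 2))) with hW
  have hCWfin : ∀ i, (coinWindow k (W i)).Finite := fun i =>
    coinWindow_finite k (finite_dualEdge_preimage_annulusPairs c (a i) (b i))
  set S : ℕ → Finset Coin := fun i => (hCWfin i).toFinset with hS
  have hSc : ∀ i, (↑(S i) : Set Coin) = coinWindow k (W i) := fun i => Set.Finite.coe_toFinset _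
  -- the pulled-back events are cylinders over the `S i`
  have hC : ∀ i ∈ s, DeterminedBy ((cfg k) ⁻¹' (D i)ᶜ) (↑(S i) : Set Coin) := by
    intro i _
    rw [hSc]
    exact determinedBy_preimage_cfg k
      (determinedBy_compl_aux (determinedBy_dualCircuitInAnnulusAt_annulus c (a i) (b i)))
  have hCm : ∀ i ∈ s, MeasurableSet ((cfg k) ⁻¹' (D i)ᶜ) := fun i _ =>
    measurable_cfg k (hDm i).compl
  -- the supports are pairwise disjoint
  have hSd : (↑s : Set ℕ).PairwiseDisjoint S := by
    intro i hi j hj hij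
    show Disjoint (S i) (S j)
    rw [← Finset.disjoint_coe, hSc, hSc, Set.disjoint_left]
    intro x hx hx'
    obtain ⟨vd, hvd, hxv⟩ := Set.mem_iUnion₂.1 hx
    obtain ⟨vd', hvd', hxv'⟩ := Set.mem_iUnion₂.1 hx'
    rcases lt_or_gt_of_ne hij with hlt | hlt
    · exact Set.disjoint_left.1 (disjoint_coinsOf_of_annuli hk
        (hfar i (Finset.mem_coe.1 hi) j (Finset.mem_coe.1 hj) hlt) hvd hvd') hxv hxv'
    · exact Set.disjoint_left.1 (disjoint_coinsOf_of_annuli hk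
        (hfar j (Finset.mem_coe.1 hj) i (Finset.mem_coe.1 hi) hlt) hvd' hvd) hxv' hxv
  -- pass to the coin space and apply the iterated independence
  rw [map_measureReal_apply (measurable_cfg k) hIm, Set.preimage_iInter₂]
  have key := prodBernoulli_real_inter_biInter_of_determinedBy (prm k ρ c₀) s S hSd hC hCm
    (determinedBy_univ _) MeasurableSet.univ
  rw [Set.univ_inter, probReal_univ, one_mul] at key
  rw [key]
  refine Finset.prod_congr rfl fun i _ => ?_
  rw [Set.preimage_compl, probReal_compl_eq_one_sub (measurable_cfg k (hDm i)),
    map_measureReal_apply (measurable_cfg k) (hDm i)]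

/-! ### The open arm excludes dual circuits in all intermediate annuli -/

/-- **An open arm crosses every intermediate annulus.**  For radii `1 ≤ aᵢ`, `m ≤ aᵢ ≤ bᵢ`,
`bᵢ + 1 ≤ n` (`i ∈ s`):
`M_k(openDualArmsAt c m n) ≤ M_k(⋂ᵢ (dualCircuitInAnnulusAt (c - 1) aᵢ bᵢ)ᶜ)` — the open lattice
walk of `openDualArmsAt` runs from `c + B(m-1) ⊆ (c-1) + 1 + B(aᵢ-1)` to the outside of
`c + B(n-1) ⊇ (c-1) + 1 + B(bᵢ)`, which is incompatible with a closed dual circuit of the dual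
annulus (`not_mem_dualCircuitInAnnulusAt_of_openWalk`; `M_k`-a.e. configuration is a lattice
configuration). -/
theorem real_openDualArmsAt_le_real_biInter (k : ℕ) (ρ c₀ : ℝ) (c : Site 2) (m n : ℕ)
    (s : Finset ℕ) (a b : ℕ → ℕ) (h : ∀ i ∈ s, 1 ≤ a i ∧ m ≤ a i ∧ a i ≤ b i ∧ b i + 1 ≤ n) :
    (M k ρ c₀).real (openDualArmsAt c m n) ≤
      (M k ρ c₀).real (⋂ i ∈ s, (dualCircuitInAnnulusAt (c - 1) (a i) (b i))ᶜ) := by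
  refine ENNReal.toReal_mono (measure_ne_top _ _) (measure_mono_ae ?_)
  have hae : ∀ᵐ ω ∂(M k ρ c₀), ω ⊆ (zdGraph 2).edgeSet :=
    selfRefinementMeasure_ae_subset_edgeSet k ρ c₀
  filter_upwards [hae] with ω hω hO
  obtain ⟨⟨u, w, p, hu, hw, hp⟩, -⟩ := (hO : ω ∈ openDualArmsAt c m n)
  refine Set.mem_iInter₂.2 fun i hi => ?_
  obtain ⟨h1, h2, h3, h4⟩ := h i hi
  refine not_mem_dualCircuitInAnnulusAt_of_openWalk h1 h3 hω p hp ?_ ?_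
  · rw [show u - (c - 1) - 1 = u - c by abel]
    exact box_mono 2 (by omega) hu
  · rw [show w - (c - 1) - 1 = w - c by abel]
    exact fun hw' => hw (box_mono 2 (by omega) hw')

/-- **Geometric annuli: `M_k(openDualArmsAt c m n) ≤ q^J`.**  If every thin annulus
`c' + A_{a,b}` with `a₀ ≤ a < b`, `2b ≤ 4(b - a)` carries a closed dual circuit with
`M_k(ρ,c₀)`-probability `≥ 1 - q`, then for `m ≥ max(a₀, 2)` and `J` annuli
`(c-1) + A_{4ⁱm, 2·4ⁱm}`, `i < J`, inside radius `n - 1`, the two-arm event has probability at most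
`q ^ J` (`k ≤ 3 < 2m` makes consecutive annuli `k`-separated). -/
theorem real_openDualArmsAt_le_pow {k : ℕ} (hk0 : 0 < k) (hk3 : k ≤ 3) (ρ c₀ : ℝ) {q : ℝ}
    {a₀ : ℕ} (hcirc : ∀ (c' : Site 2) (a b : ℕ), a₀ ≤ a → a < b → 2 * b ≤ 4 * (b - a) →
      1 - q ≤ (M k ρ c₀).real (dualCircuitInAnnulusAt c' a b))
    (c : Site 2) {m n J : ℕ} (hm0 : a₀ ≤ m) (hm2 : 2 ≤ m)
    (hJ : ∀ i < J, 2 * (4 ^ i * m) + 1 ≤ n) :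
    (M k ρ c₀).real (openDualArmsAt c m n) ≤ q ^ J := by
  haveI := isProbabilityMeasure_M k ρ c₀
  have hpow : ∀ i : ℕ, m ≤ 4 ^ i * m := fun i =>
    Nat.le_mul_of_pos_left m (Nat.one_le_pow _ _ (by norm_num))
  have hgeom : ∀ i ∈ Finset.range J, 1 ≤ 4 ^ i * m ∧ m ≤ 4 ^ i * m ∧ 4 ^ i * m ≤ 2 * (4 ^ i * m) ∧
      2 * (4 ^ i * m) + 1 ≤ n := by
    intro i hi
    have h2 := hpow i
    have h3 := hJ i (Finset.mem_range.1 hi)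
    omega
  have hfar : ∀ i ∈ Finset.range J, ∀ j ∈ Finset.range J, i < j →
      2 * (4 ^ i * m) + k ≤ 4 ^ j * m := by
    intro i _ j _ hij
    have h1 : 4 ^ (i + 1) ≤ 4 ^ j := Nat.pow_le_pow_right (by norm_num) hij
    have h2 : 4 ^ (i + 1) * m ≤ 4 ^ j * m := Nat.mul_le_mul_right m h1
    have h3 : 4 ^ (i + 1) * m = 4 * (4 ^ i * m) := by ring
    have h4 := hpow i
    omega
  have hq : ∀ i ∈ Finset.range J,
      1 - (M k ρ c₀).real (dualCircuitInAnnulusAt (c - 1) (4 ^ i * m) (2 * (4 ^ i * m))) ≤ q := by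
    intro i _
    have h4 := hpow i
    have := hcirc (c - 1) (4 ^ i * m) (2 * (4 ^ i * m)) (by omega) (by omega) (by omega)
    linarith
  calc (M k ρ c₀).real (openDualArmsAt c m n)
      ≤ (M k ρ c₀).real (⋂ i ∈ Finset.range J,
          (dualCircuitInAnnulusAt (c - 1) (4 ^ i * m) (2 * (4 ^ i * m)))ᶜ) :=
        real_openDualArmsAt_le_real_biInter k ρ c₀ c m n (Finset.range J) (fun i => 4 ^ i * m)
          (fun i => 2 * (4 ^ i * m)) hgeom
    _ = ∏ i ∈ Finset.range J,
          (1 - (M k ρ c₀).real (dualCircuitInAnnulusAt (c - 1) (4 ^ i * m) (2 * (4 ^ i * m)))) :=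
        real_biInter_compl_dualCircuitInAnnulusAt_eq_prod hk0 ρ c₀ (c - 1) (Finset.range J)
          (fun i => 4 ^ i * m) (fun i => 2 * (4 ^ i * m)) hfar
    _ ≤ ∏ _i ∈ Finset.range J, q :=
        Finset.prod_le_prod (fun i _ => sub_nonneg.2 measureReal_le_one) hq
    _ = q ^ J := by rw [Finset.prod_const, Finset.card_range]

end Summit.CriticalPhenomena.CardyFormulaZ2.Theorems.CardySelfRefinement.FarField

end
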